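import Mathlib
import HarnessLib
import Summits.NavierStokesRegularity.NavierStokesRegularity.Theorems.PoloidalWindowDoorLrcModEntireCaseIEntrance
import Summits.NavierStokesRegularity.NavierStokesRegularity.Theorems.PoloidalWindowDoorLrcModEntireLineLeverAtTime

/-!
# Route `PoloidalWindowDoor`, item `LrcModEntire` (stmt-NavierStokesRegularity-20428), cell (Q4-sonic, straight, μ < 0) `stub_Q4sonicLineNeg` —
# CASE II «τ = 0 an isolated sonic time»: THE ENTRANCE — the v14 child `stub_Q4sonicLineNegIsolated` reduces to ONE typed END, the curved web at a non-sonic time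

Cell ns-regularity-ideate, stub-worker seat ns-poloidal-K2-p2 g17 under the LEAD of item 20428 (ns-poloidal-K2-p3 g17; memo T2B-g17 §1 CASE II, §5(5f),
`CASE-I-SPLIT-v14.md` Child 2); `--supports stmt-NavierStokesRegularity-20428 --as helper`.  The analogue for case II of `…CaseISonicTimes.caseI_false_of_ends`:

★★ `caseII_false_of_curvedEnd (hCurvedEnd) : <Child 2 VERBATIM>` — from the binders of the child: the pin-free, hot-free space–time web package on a box
(`…Q4TimeWebPackage.time_web_package_line`: the maximiser `n₀(τ,s,z)`, its smoothness, criticality, the sheet Hessian trace `κt`, Huygens), `μ(−1,0) < 0`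
(`…CaseIEntrance.slope_neg_of_package` from the v9 literal «`R(0,·)` affine») hence `μ < 0` on a smaller box (continuity), the frame form of the (Q4) data over the
straight branch (`…Q4LineWeb.line_frame`), the ISOLATION literal turned positive («in every time window there is a NON-sonic time»), and — the kernel content — at every
non-sonic time `τ` of the box the base web `s ↦ n₀(τ,s,0)` is NOT constant: a constant one is a PIN for K2-p2 g16's ★ `…LineLeverAtTime.line_lever_at_time`
(parallel webs + Huygens at time `−1+τ`, a non-characteristic height, Cauchy–Kovalevskaya across the flat sheet, the horizontal germ), which ends in `False`.
What is handed to `hCurvedEnd` is exactly T2B-g17 §5(5f): «the slot survives only if for small `τ ≠ 0` the webs are genuinely CURVED / `s`-modulated at a NON-sonic,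
NON-hot time» — the (Q4-curved) object at time `−1+τ` stripped of its hot normalisation (T2B-g17 §6), with the whole hull-element package kept for the successor.

WHAT THIS IS NOT: not a claim about Navier–Stokes regularity; it closes nothing — it TYPES the research residue of the slot after v14; `stub_Q4sonicLineNegIsolated`
stays `sorry` in the registry; items 20428 / 19708 / 27893 OPEN (bears_on LADDER-NS N0).
-/

noncomputable section

set_option linter.dupNamespace false
set_option linter.style.longLine false

namespace Summit.NavierStokesRegularity.NavierStokesRegularity.Theorems.PoloidalWindowDoorLrcModEntireCaseIIEntrance

open Set Function Filter Topology Metric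
open scoped RealInnerProductSpace InnerProductSpace ContDiff Laplacian
open Literature.Analysis Literature.Analysis.FluidPDE Literature.Analysis.UnboundedOperators
open Summit.NavierStokesRegularity.NavierStokesRegularity.Theorems.LocalSineTubeDoorProfileAlignedWindowRigidityAncient
open Summit.NavierStokesRegularity.NavierStokesRegularity.Theorems.PoloidalWindowDoorPoloidalWindowRigidityWindow
open Summit.NavierStokesRegularity.NavierStokesRegularity.Theorems.PoloidalWindowDoorLrcModEntireSheetFlattenTools
open Summit.NavierStokesRegularity.NavierStokesRegularity.Theorems.PoloidalWindowDoorLrcModEntireQ4LineWeb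
open Summit.NavierStokesRegularity.NavierStokesRegularity.Theorems.PoloidalWindowDoorLrcModEntireQ4TimeWebPackage
open Summit.NavierStokesRegularity.NavierStokesRegularity.Theorems.PoloidalWindowDoorLrcModEntireCaseIEntrance
open Summit.NavierStokesRegularity.NavierStokesRegularity.Theorems.PoloidalWindowDoorLrcModEntireLineLeverAtTime

/-- ★★ **CASE II «τ = 0 an isolated sonic time» OF `stub_Q4sonicLineNeg` REDUCES TO THE CURVED END.**  Conclusion: the v14 child `stub_Q4sonicLineNegIsolated`
VERBATIM.  Hypothesis `hCurvedEnd`: the hull-element package in frame form + the space–time web package on a box + «non-sonic times accumulate at 0» + «at every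
non-sonic time of the box the base web is not an `e`-parallel line» ⊢ `False` (see the module docstring). -/
theorem caseII_false_of_curvedEnd
    (hCurvedEnd : ∀ (C σ κ ρ δ' r δ m : ℝ) (U : ℝ → EuclideanSpace ℝ (Fin 3) → EuclideanSpace ℝ (Fin 3)) (R μ : ℝ → ℝ → ℝ)
      (e : EuclideanSpace ℝ (Fin 3)) (n₀ : ℝ × ℝ × ℝ → ℝ) (κt : ℝ → ℝ → ℝ),
      -- the hull element: class, hot value, Type-I hot bound, flat hot spot, time normalisation, peakless slices, critical hot set, (TH) structure
      Literature.Analysis.FluidPDE.HasTypeITimeDecay C U →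
      ContinuousOn (Function.uncurry U) (Set.Iio (0 : ℝ) ×ˢ Set.univ) →
      (∀ s t : ℝ, s < t → t < 0 → ∀ x, U t x =
        Literature.Analysis.UnboundedOperators.heatExtension (U s) (t - s) x - Literature.Analysis.FluidPDE.oseenDuhamel 1 s U U t x) →
      (∀ t < 0, Literature.Analysis.FluidPDE.VectorCalculus.IsDivFree (U t)) →
      (∀ s < 0, ∀ q, ⟪Literature.Analysis.FluidPDE.curl (U s) q, EuclideanSpace.single 2 1⟫_ℝ = 0) →
      U (-1) 0 2 ≠ 0 → (∀ t < 0, ∀ x, Real.sqrt (-t) * |U t x 2| ≤ |U (-1) 0 2|) →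
      (∀ h : EuclideanSpace ℝ (Fin 3), fderiv ℝ (U (-1)) 0 h 2 = 0) →
      (deriv (fun s => U s 0 2) (-1) = U (-1) 0 2 / 2 ∧ U (-1) 0 2 * (Δ (fun q => U (-1) q 2)) 0 ≤ 0) →
      (∀ (s z₀ σ M : ℝ) (K O : Set (EuclideanSpace ℝ (Fin 3))), s < 0 →
        ((σ = 1 ∨ σ = -1) ∧ IsCompact K ∧ K.Nonempty ∧ (∀ q ∈ K, q 2 = z₀ ∧ σ * U s q 2 = M) ∧
          IsOpen O ∧ K ⊆ O ∧ (∀ q ∈ O, q 2 = z₀ → σ * U s q 2 ≤ M) ∧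
          (∀ q ∈ O, q 2 = z₀ → σ * U s q 2 = M → q ∈ K)) → False) →
      (∀ y ∈ {y : EuclideanSpace ℝ (Fin 3) | y 2 = 0 ∧ U (-1) y 2 = U (-1) 0 2}, fderiv ℝ (fun x => U (-1) x 2) y = 0) →
      (∀ t < 0, ∀ x x' : EuclideanSpace ℝ (Fin 3), x 2 = x' 2 → ∀ b c : Fin 3, b ≠ 2 → c ≠ 2 →
        fderiv ℝ (U t) x (EuclideanSpace.single 2 1) b * fderiv ℝ (U t) x' (EuclideanSpace.single c 1) 2 =
          fderiv ℝ (U t) x' (EuclideanSpace.single 2 1) c * fderiv ℝ (U t) x (EuclideanSpace.single b 1) 2) →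
      (∀ s < 0, ∀ y, ⟪fderiv ℝ (U s) y (Literature.Analysis.FluidPDE.curl (U s) y), EuclideanSpace.single 2 1⟫_ℝ = 0) →
      -- sign, curvature scale, slope function, slab law (pointwise and eventually form), radii
      (σ = 1 ∨ σ = -1) → σ * U (-1) 0 2 = |U (-1) 0 2| → 0 < κ → ContDiff ℝ 3 (Function.uncurry μ) → 0 < ρ → ρ ≤ 1 →
      (∀ t : ℝ, |t + 1| < ρ → ∀ x : EuclideanSpace ℝ (Fin 3), |x 2| < ρ → ∀ b : Fin 3, b ≠ 2 →
        fderiv ℝ (U t) x (EuclideanSpace.single 2 1) b = μ t (x 2) * fderiv ℝ (U t) x (EuclideanSpace.single b 1) 2) →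
      (∀ t₀ : ℝ, |t₀ + 1| < ρ → ∀ y₀ : EuclideanSpace ℝ (Fin 3), y₀ 2 = 0 →
        ∀ᶠ z in 𝓝 ((t₀, y₀) : ℝ × EuclideanSpace ℝ (Fin 3)), ∀ b : Fin 3, b ≠ 2 →
          fderiv ℝ (U z.1) z.2 (EuclideanSpace.single 2 1) b = μ z.1 (z.2 2) * fderiv ℝ (U z.1) z.2 (EuclideanSpace.single b 1) 2) →
      0 < r → 0 < δ → δ ≤ 1 / 4 →
      -- the STRAIGHT hot branch `s ↦ s • e` in frame form: horizontal unit direction, hot line, transversal curvature bound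
      e 2 = 0 → e 0 ^ 2 + e 1 ^ 2 = 1 →
      (∀ s : ℝ, U (-1) (frameCLM e (s, (0 : ℝ), (0 : ℝ))) 2 = U (-1) 0 2) →
      (∀ s : ℝ, κ ≤ -(fderiv ℝ (fderiv ℝ (fun y => σ * U (-1) y 2)) (frameCLM e (s, (0 : ℝ), (0 : ℝ))) (Jvec e) (Jvec e))) →
      -- (Q3∞), cold lateral values, hot centre, strict concavity, web Fermat law on the `δ`-box (frame form)
      (∀ τ z : ℝ, |τ| < δ → |z| < δ → ∀ s : ℝ,
        sSup ((fun n : ℝ => σ * U (-1 + τ) (frameCLM e (s, n, z)) 2) '' Set.Icc (-r) r) = R τ z) →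
      (∀ τ z : ℝ, |τ| < δ → |z| < δ → ∀ s n : ℝ, (n = r ∨ n = -r) → σ * U (-1 + τ) (frameCLM e (s, n, z)) 2 < m) →
      (∀ τ z : ℝ, |τ| < δ → |z| < δ → ∀ s : ℝ, m ≤ σ * U (-1 + τ) (frameCLM e (s, (0 : ℝ), z)) 2) →
      (∀ τ z : ℝ, |τ| < δ → |z| < δ → ∀ s : ℝ, ∀ n ∈ Set.Ioo (-r) r,
        fderiv ℝ (fderiv ℝ (fun y => σ * U (-1 + τ) y 2)) (frameCLM e (s, n, z)) (Jvec e) (Jvec e) < 0) →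
      (∀ τ₀ z₀ : ℝ, |τ₀| < δ → |z₀| < δ → ∀ s₀ : ℝ, ∃ n₀ ∈ Set.Ioo (-r) r,
        σ * U (-1 + τ₀) (frameCLM e (s₀, n₀, z₀)) 2 = R τ₀ z₀ ∧
        (∀ n ∈ Set.Icc (-r) r, n ≠ n₀ → σ * U (-1 + τ₀) (frameCLM e (s₀, n, z₀)) 2 < R τ₀ z₀) ∧
        DifferentiableAt ℝ (Function.uncurry R) (τ₀, z₀) ∧
        fderiv ℝ (Function.uncurry fun τ y => σ * U (-1 + τ) y 2) (τ₀, frameCLM e (s₀, n₀, z₀)) =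
          (fderiv ℝ (Function.uncurry R) (τ₀, z₀)).comp
            ((ContinuousLinearMap.fst ℝ ℝ (EuclideanSpace ℝ (Fin 3))).prod
              ((EuclideanSpace.proj (2 : Fin 3)).comp (ContinuousLinearMap.snd ℝ ℝ (EuclideanSpace ℝ (Fin 3)))))) →
      -- THE SPACE–TIME WEB PACKAGE on the `δ′`-box (`…Q4TimeWebPackage.time_web_package_line`), webs parallel at `τ = 0`, negative slope on the box
      0 < δ' → δ' ≤ δ → δ' ≤ ρ → δ' < 1 / 2 →
      (∀ q : ℝ × ℝ × ℝ, |q.1| < δ' → |q.2.2| < δ' →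
        n₀ q ∈ Set.Ioo (-r) r ∧
        σ * U (-1 + q.1) (frameCLM e (q.2.1, n₀ q, q.2.2)) 2 = R q.1 q.2.2 ∧
        (∀ n ∈ Set.Icc (-r) r, n ≠ n₀ q → σ * U (-1 + q.1) (frameCLM e (q.2.1, n, q.2.2)) 2 < R q.1 q.2.2) ∧
        (∀ w : EuclideanSpace ℝ (Fin 3), w 2 = 0 → fderiv ℝ (fun y => U (-1 + q.1) y 2) (frameCLM e (q.2.1, n₀ q, q.2.2)) w = 0) ∧
        (∀ m : ℕ∞, ContDiffAt ℝ m n₀ q) ∧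
        0 < κt q.1 q.2.2 ∧
        fderiv ℝ (fderiv ℝ (fun y => σ * U (-1 + q.1) y 2)) (frameCLM e (q.2.1, n₀ q, q.2.2)) e e +
            fderiv ℝ (fderiv ℝ (fun y => σ * U (-1 + q.1) y 2)) (frameCLM e (q.2.1, n₀ q, q.2.2)) (Jvec e) (Jvec e) =
          -κt q.1 q.2.2 ∧
        κt q.1 q.2.2 * (fderiv ℝ n₀ q ((0 : ℝ), (0 : ℝ), (1 : ℝ))) ^ 2 =
          (deriv (deriv (R q.1)) q.2.2 - μ (-1 + q.1) q.2.2 * κt q.1 q.2.2) * (1 + (fderiv ℝ n₀ q ((0 : ℝ), (1 : ℝ), (0 : ℝ))) ^ 2)) →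
      (∀ s z : ℝ, |z| < δ' → n₀ ((0 : ℝ), s, z) = n₀ ((0 : ℝ), (0 : ℝ), z)) →
      (∀ τ z : ℝ, |τ| < δ' → |z| < δ' → μ (-1 + τ) z < 0) →
      -- CASE II: non-sonic times accumulate at `τ = 0` …
      (∀ δ'' : ℝ, 0 < δ'' → ∃ τ : ℝ, |τ| < δ'' ∧ ¬ (∃ a b : ℝ, ∀ z : ℝ, |z| < δ → R τ z = a + b * z)) →
      -- … and at every non-sonic time of the box the base web is NOT an `e`-parallel line (the LINE lever `…LineLeverAtTime`)
      (∀ τ : ℝ, |τ| < δ' → ¬ (∃ a b : ℝ, ∀ z : ℝ, |z| < δ → R τ z = a + b * z) →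
        ∃ s : ℝ, n₀ (τ, s, (0 : ℝ)) ≠ n₀ (τ, (0 : ℝ), (0 : ℝ))) →
      False) :
    ∀ (C : ℝ) (v : ℝ → EuclideanSpace ℝ (Fin 3) → EuclideanSpace ℝ (Fin 3)) (W : Set (ℝ × EuclideanSpace ℝ (Fin 3))),
      (Literature.Analysis.FluidPDE.HasTypeITimeDecay C v ∧
        ContinuousOn (Function.uncurry v) (Set.Iio (0 : ℝ) ×ˢ Set.univ) ∧
        (∀ s t : ℝ, s < t → t < 0 → ∀ x, v t x =
          Literature.Analysis.UnboundedOperators.heatExtension (v s) (t - s) x -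
            Literature.Analysis.FluidPDE.oseenDuhamel 1 s v v t x) ∧
        (∀ t < 0, Literature.Analysis.FluidPDE.VectorCalculus.IsDivFree (v t)) ∧
        (∀ s < 0, ∀ y, ⟪Literature.Analysis.FluidPDE.curl (v s) y, EuclideanSpace.single 2 1⟫_ℝ = 0) ∧
        v (-1) 0 2 ≠ 0 ∧ (∀ t < 0, ∀ x, Real.sqrt (-t) * |v t x 2| ≤ |v (-1) 0 2|) ∧
        (∀ h : EuclideanSpace ℝ (Fin 3), fderiv ℝ (v (-1)) 0 h 2 = 0) ∧
        (deriv (fun s => v s 0 2) (-1) = v (-1) 0 2 / 2 ∧ v (-1) 0 2 * (Δ (fun y => v (-1) y 2)) 0 ≤ 0)) →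
      (IsOpen W ∧ W.Nonempty ∧ W ⊆ Set.Iio (0 : ℝ) ×ˢ Set.univ ∧
        (∀ z ∈ W, (Literature.Analysis.FluidPDE.curl (v z.1) z.2 ≠ 0 ∧
            (fderiv ℝ (v z.1) z.2 (EuclideanSpace.single 0 1) 2 ≠ 0 ∨ fderiv ℝ (v z.1) z.2 (EuclideanSpace.single 1 1) 2 ≠ 0) ∧
            (fderiv ℝ (v z.1) z.2 (EuclideanSpace.single 2 1) 0 ≠ 0 ∨ fderiv ℝ (v z.1) z.2 (EuclideanSpace.single 2 1) 1 ≠ 0))) ∧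
        (∀ m : ℝ → ℝ, ∀ W₁ : Set (ℝ × EuclideanSpace ℝ (Fin 3)), W₁ ⊆ W → IsOpen W₁ → W₁.Nonempty →
            ∃ z ∈ W₁, ∃ b : Fin 3, b ≠ 2 ∧
              fderiv ℝ (v z.1) z.2 (EuclideanSpace.single 2 1) b ≠
                m z.1 * fderiv ℝ (v z.1) z.2 (EuclideanSpace.single b 1) 2) ∧
        (∀ z ∈ W, (fderiv ℝ (fun x => fderiv ℝ (v z.1) x (EuclideanSpace.single 2 1) 2) z.2 (EuclideanSpace.single 0 1) *
                fderiv ℝ (v z.1) z.2 (EuclideanSpace.single 1 1) 2 -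
              fderiv ℝ (fun x => fderiv ℝ (v z.1) x (EuclideanSpace.single 2 1) 2) z.2 (EuclideanSpace.single 1 1) *
                fderiv ℝ (v z.1) z.2 (EuclideanSpace.single 0 1) 2 ≠ 0)) ∧
        (∃ m : ℝ → ℝ → ℝ, ∀ z ∈ W, ∀ b : Fin 3, b ≠ 2 →
            fderiv ℝ (v z.1) z.2 (EuclideanSpace.single 2 1) b =
              m z.1 (z.2 2) * fderiv ℝ (v z.1) z.2 (EuclideanSpace.single b 1) 2)) →
      (∀ t < 0, ∀ x x' : EuclideanSpace ℝ (Fin 3), x 2 = x' 2 → ∀ b c : Fin 3, b ≠ 2 → c ≠ 2 →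
        fderiv ℝ (v t) x (EuclideanSpace.single 2 1) b * fderiv ℝ (v t) x' (EuclideanSpace.single c 1) 2 =
          fderiv ℝ (v t) x' (EuclideanSpace.single 2 1) c * fderiv ℝ (v t) x (EuclideanSpace.single b 1) 2) →
      (∀ (s z₀ σ M : ℝ) (K O : Set (EuclideanSpace ℝ (Fin 3))), s < 0 →
        ((σ = 1 ∨ σ = -1) ∧ IsCompact K ∧ K.Nonempty ∧ (∀ y ∈ K, y 2 = z₀ ∧ σ * v s y 2 = M) ∧
          IsOpen O ∧ K ⊆ O ∧ (∀ y ∈ O, y 2 = z₀ → σ * v s y 2 ≤ M) ∧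
          (∀ y ∈ O, y 2 = z₀ → σ * v s y 2 = M → y ∈ K)) → False) →
      (∀ s < 0, ∀ y, ⟪fderiv ℝ (v s) y (Literature.Analysis.FluidPDE.curl (v s) y), EuclideanSpace.single 2 1⟫_ℝ = 0) →
      IsClosed ({y : EuclideanSpace ℝ (Fin 3) | y 2 = 0 ∧ v (-1) y 2 = v (-1) 0 2}) →
      (∀ y ∈ {y : EuclideanSpace ℝ (Fin 3) | y 2 = 0 ∧ v (-1) y 2 = v (-1) 0 2}, fderiv ℝ (fun x => v (-1) x 2) y = 0) →
      (∀ K O : Set (EuclideanSpace ℝ (Fin 3)), IsCompact K → K.Nonempty → K ⊆ {y : EuclideanSpace ℝ (Fin 3) | y 2 = 0 ∧ v (-1) y 2 = v (-1) 0 2} →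
        IsOpen O → K ⊆ O → O ∩ {y : EuclideanSpace ℝ (Fin 3) | y 2 = 0 ∧ v (-1) y 2 = v (-1) 0 2} ⊆ K → False) →
      (∀ y ∈ {y : EuclideanSpace ℝ (Fin 3) | y 2 = 0 ∧ v (-1) y 2 = v (-1) 0 2}, ∀ r : ℝ, 0 < r →
        ∃ y' : EuclideanSpace ℝ (Fin 3), y' 2 = 0 ∧ dist y' y < r ∧ v (-1) y' 2 ≠ v (-1) 0 2) →
      (∀ y ∈ {y : EuclideanSpace ℝ (Fin 3) | y 2 = 0 ∧ v (-1) y 2 = v (-1) 0 2}, Literature.Analysis.FluidPDE.curl (v (-1)) y = 0) →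
      ∀ (σ κ : ℝ) (y₁ : EuclideanSpace ℝ (Fin 3)) (c₁ : Fin 3), (σ = 1 ∨ σ = -1) → σ * v (-1) 0 2 = |v (-1) 0 2| → 0 < κ →
        (∀ y : EuclideanSpace ℝ (Fin 3), y 2 = 0 → v (-1) y 2 = v (-1) 0 2 →
          fderiv ℝ (fderiv ℝ (fun x => σ * v (-1) x 2)) y (EuclideanSpace.single 0 1) (EuclideanSpace.single 0 1) +
            fderiv ℝ (fderiv ℝ (fun x => σ * v (-1) x 2)) y (EuclideanSpace.single 1 1) (EuclideanSpace.single 1 1) = -κ) →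
        y₁ 2 = 0 → c₁ ≠ 2 → fderiv ℝ (v (-1)) y₁ (EuclideanSpace.single c₁ 1) 2 ≠ 0 →
        (∃ (γ : ℝ → EuclideanSpace ℝ (Fin 3)) (φ : ℕ → ℕ) (U : ℝ → EuclideanSpace ℝ (Fin 3) → EuclideanSpace ℝ (Fin 3)) (Γ νΓ : ℝ → EuclideanSpace ℝ (Fin 3))
        (F : ℝ → EuclideanSpace ℝ (Fin 3) → ℝ) (R : ℝ → ℝ → ℝ) (r δ m : ℝ) (μ : ℝ → ℝ → ℝ) (ρ : ℝ),
        -- the complete hot branch of BRANCH-PARAM (LEAD g15 `exists_complete_hotBranch_of_ridge`)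
        ((ContDiff ℝ 2 γ ∧ γ 0 = 0 ∧ (∀ s, γ s 2 = 0) ∧ (∀ s, ‖deriv γ s‖ = 1) ∧ (∀ s, v (-1) (γ s) 2 = v (-1) 0 2) ∧
          (∀ s, fderiv ℝ (fderiv ℝ (fun y => σ * v (-1) y 2)) (γ s) (WithLp.toLp 2 ![-(deriv γ s 1), deriv γ s 0, 0])
            (WithLp.toLp 2 ![-(deriv γ s 1), deriv γ s 0, 0]) = -κ) ∧
          (∀ s w, fderiv ℝ (fderiv ℝ (fun y => σ * v (-1) y 2)) (γ s) (deriv γ s) w = 0)) ∧ StrictMono φ ∧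
        -- the hull limit (pinned, peakless, same hot value), slices converging locally uniformly, re-based branches converging to `Γ`
        (Literature.Analysis.FluidPDE.HasTypeITimeDecay C U ∧
          ContinuousOn (Function.uncurry U) (Set.Iio (0 : ℝ) ×ˢ Set.univ) ∧
          (∀ s t : ℝ, s < t → t < 0 → ∀ x, U t x =
            Literature.Analysis.UnboundedOperators.heatExtension (U s) (t - s) x -
              Literature.Analysis.FluidPDE.oseenDuhamel 1 s U U t x) ∧
          (∀ t < 0, Literature.Analysis.FluidPDE.VectorCalculus.IsDivFree (U t)) ∧
          (∀ s < 0, ∀ q, ⟪Literature.Analysis.FluidPDE.curl (U s) q, EuclideanSpace.single 2 1⟫_ℝ = 0) ∧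
          U (-1) 0 2 ≠ 0 ∧ (∀ t < 0, ∀ x, Real.sqrt (-t) * |U t x 2| ≤ |U (-1) 0 2|) ∧
          (∀ h : EuclideanSpace ℝ (Fin 3), fderiv ℝ (U (-1)) 0 h 2 = 0) ∧
          (deriv (fun s => U s 0 2) (-1) = U (-1) 0 2 / 2 ∧ U (-1) 0 2 * (Δ (fun q => U (-1) q 2)) 0 ≤ 0)) ∧
        (∀ (s z₀ σ M : ℝ) (K O : Set (EuclideanSpace ℝ (Fin 3))), s < 0 →
          ((σ = 1 ∨ σ = -1) ∧ IsCompact K ∧ K.Nonempty ∧ (∀ q ∈ K, q 2 = z₀ ∧ σ * U s q 2 = M) ∧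
            IsOpen O ∧ K ⊆ O ∧ (∀ q ∈ O, q 2 = z₀ → σ * U s q 2 ≤ M) ∧
            (∀ q ∈ O, q 2 = z₀ → σ * U s q 2 = M → q ∈ K)) → False) ∧
        U (-1) 0 2 = v (-1) 0 2 ∧
        (∀ t < 0, TendstoLocallyUniformly (fun j x => v t (x + γ ((φ j : ℕ) : ℝ))) (U t) atTop) ∧
        (∀ s, Tendsto (fun j => γ (((φ j : ℕ) : ℝ) + s) - γ ((φ j : ℕ) : ℝ)) atTop (𝓝 (Γ s))) ∧
        -- re-entry package of the limit branch
        (∀ y ∈ {y : EuclideanSpace ℝ (Fin 3) | y 2 = 0 ∧ U (-1) y 2 = U (-1) 0 2}, fderiv ℝ (fun x => U (-1) x 2) y = 0) ∧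
        ContDiff ℝ ∞ Γ ∧ Γ 0 = 0 ∧ (∀ s, Γ s 2 = 0) ∧ (∀ s, ‖deriv Γ s‖ = 1) ∧ (∀ s, U (-1) (Γ s) 2 = U (-1) 0 2) ∧
        (∀ s, νΓ s = WithLp.toLp 2 ![-(deriv Γ s 1), deriv Γ s 0, 0]) ∧
        (∀ s, κ ≤ -(fderiv ℝ (fderiv ℝ (fun y => σ * U (-1) y 2)) (Γ s) (νΓ s) (νΓ s))) ∧
        -- the signed space–time component, the homogeneous ridge height, the tube radius, the window, the level
        (F = fun τ y => σ * U (-1 + τ) y 2) ∧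
        (∀ τ z, R τ z = sSup ((fun n : ℝ => F τ (Γ 0 + n • νΓ 0 + z • EuclideanSpace.single 2 (1 : ℝ))) '' Icc (-r) r)) ∧
        0 < r ∧ 0 < δ ∧ δ ≤ 1 / 4 ∧
        -- (Q3∞): the cross-section maximum is homogeneous along `Γ`
        (∀ τ z : ℝ, |τ| < δ → |z| < δ → ∀ s : ℝ,
          sSup ((fun n : ℝ => F τ (Γ s + n • νΓ s + z • EuclideanSpace.single 2 (1 : ℝ))) '' Icc (-r) r) = R τ z) ∧
        -- cold lateral values, hot centre
        (∀ τ z : ℝ, |τ| < δ → |z| < δ → ∀ s n : ℝ, (n = r ∨ n = -r) → F τ (Γ s + n • νΓ s + z • EuclideanSpace.single 2 (1 : ℝ)) < m) ∧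
        (∀ τ z : ℝ, |τ| < δ → |z| < δ → ∀ s : ℝ, m ≤ F τ (Γ s + z • EuclideanSpace.single 2 (1 : ℝ))) ∧
        -- strict concavity of the cross-sections on the open tube
        (∀ τ z : ℝ, |τ| < δ → |z| < δ → ∀ s : ℝ, ∀ n ∈ Ioo (-r) r,
          fderiv ℝ (fderiv ℝ (F τ)) (Γ s + n • νΓ s + z • EuclideanSpace.single 2 (1 : ℝ)) (νΓ s) (νΓ s) < 0) ∧
        -- THE WEB FERMAT LAW at every cross-section
        (∀ τ₀ z₀ : ℝ, |τ₀| < δ → |z₀| < δ → ∀ s₀ : ℝ, ∃ n₀ ∈ Ioo (-r) r,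
          F τ₀ (Γ s₀ + n₀ • νΓ s₀ + z₀ • EuclideanSpace.single 2 (1 : ℝ)) = R τ₀ z₀ ∧
          (∀ n ∈ Icc (-r) r, n ≠ n₀ → F τ₀ (Γ s₀ + n • νΓ s₀ + z₀ • EuclideanSpace.single 2 (1 : ℝ)) < R τ₀ z₀) ∧
          DifferentiableAt ℝ (uncurry R) (τ₀, z₀) ∧
          fderiv ℝ (uncurry F) (τ₀, Γ s₀ + n₀ • νΓ s₀ + z₀ • EuclideanSpace.single 2 (1 : ℝ)) =
            (fderiv ℝ (uncurry R) (τ₀, z₀)).comp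
              ((ContinuousLinearMap.fst ℝ ℝ (EuclideanSpace ℝ (Fin 3))).prod
                ((EuclideanSpace.proj (2 : Fin 3)).comp (ContinuousLinearMap.snd ℝ ℝ (EuclideanSpace ℝ (Fin 3)))))) ∧
        -- (TH) STRUCTURE OF THE HULL ELEMENT: the global bilinear identity, the frozen law, and the slope function of `v` on a uniform slab — the SAME `μ` for `U`
        (∀ t < 0, ∀ x x' : EuclideanSpace ℝ (Fin 3), x 2 = x' 2 → ∀ b c : Fin 3, b ≠ 2 → c ≠ 2 →
          fderiv ℝ (U t) x (EuclideanSpace.single 2 1) b * fderiv ℝ (U t) x' (EuclideanSpace.single c 1) 2 =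
            fderiv ℝ (U t) x' (EuclideanSpace.single 2 1) c * fderiv ℝ (U t) x (EuclideanSpace.single b 1) 2) ∧
        (∀ s < 0, ∀ y, ⟪fderiv ℝ (U s) y (Literature.Analysis.FluidPDE.curl (U s) y), EuclideanSpace.single 2 1⟫_ℝ = 0) ∧
        0 < ρ ∧ ρ ≤ 1 ∧ ContDiff ℝ 3 (uncurry μ) ∧
        μ (-1) 0 = fderiv ℝ (v (-1)) y₁ (EuclideanSpace.single 2 1) c₁ / fderiv ℝ (v (-1)) y₁ (EuclideanSpace.single c₁ 1) 2 ∧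
        (∀ t : ℝ, |t + 1| < ρ → ∀ x : EuclideanSpace ℝ (Fin 3), |x 2| < ρ → ∀ b : Fin 3, b ≠ 2 →
          fderiv ℝ (v t) x (EuclideanSpace.single 2 1) b = μ t (x 2) * fderiv ℝ (v t) x (EuclideanSpace.single b 1) 2) ∧
        (∀ t : ℝ, |t + 1| < ρ → ∀ x : EuclideanSpace ℝ (Fin 3), |x 2| < ρ → ∀ b : Fin 3, b ≠ 2 →
          fderiv ℝ (U t) x (EuclideanSpace.single 2 1) b = μ t (x 2) * fderiv ℝ (U t) x (EuclideanSpace.single b 1) 2) ∧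
        (∀ t₀ : ℝ, |t₀ + 1| < ρ → ∀ y₀ : EuclideanSpace ℝ (Fin 3), y₀ 2 = 0 →
          ∀ᶠ z in 𝓝 ((t₀, y₀) : ℝ × EuclideanSpace ℝ (Fin 3)), ∀ b : Fin 3, b ≠ 2 →
            fderiv ℝ (U z.1) z.2 (EuclideanSpace.single 2 1) b = μ z.1 (z.2 2) * fderiv ℝ (U z.1) z.2 (EuclideanSpace.single b 1) 2)) ∧
        -- (v9) the sub-cell
        (∃ a b : ℝ, ∀ z : ℝ, |z| < δ → R 0 z = a + b * z) ∧
        -- (v11) the sub-sub-cell: straight branch, non-vanishing (hence negative) slope at the hot spot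
        (∀ s : ℝ, Γ s = s • deriv Γ 0) ∧ ¬ (μ (-1) 0 = 0) ∧
        -- (v14) CASE II: the sonic time τ = 0 is isolated (research: curved s-modulated webs at nearby non-sonic times)
        (¬ (∃ δ' : ℝ, 0 < δ' ∧ ∀ τ : ℝ, |τ| < δ' → ∃ a b : ℝ, ∀ z : ℝ, |z| < δ → R τ z = a + b * z))) →
        False := by
  intro C v W hv hW hbilv hpeak hfrozen hHcl hHgrad hHcomp hHiso hHcurl σ κ y₁ c₁ hσ hσN hκ hHlap hy₁ hc₁ hslope₁ hobj
  obtain ⟨γ, φ, U, Γ, νΓ, F, R, r, δ, m, μ, ρ, ⟨-, -, hUclass, hUpeak, hUN, -, -, hUcrit, -, hΓ0, hΓ2, hΓunit, hΓhot, hν, hΓcurv, hFdef, -,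
    hr, hδ, hδ4, hQ3, hcold, hhot, hconc, hweb, hbil, hUcurl, hρ, hρ1, hμ3, -, -, hslabU, hevU⟩, hson, hline, hμ0, hII⟩ := hobj
  obtain ⟨hUrate, hUcont, hUmild, hUdiv, hUpol, hUne, hUhotbd, hUflat, hUtime⟩ := hUclass
  have hσN' : σ * U (-1) 0 2 = |U (-1) 0 2| := by rw [hUN, hσN]
  subst hFdef
  beta_reduce at hQ3 hcold hhot hconc hweb
  -- the space–time web package on a box (pin-free, hot-free)
  obtain ⟨δ', n₀, κt, hδ'pos, hδ'δ, hδ'ρ, hδ'h, he2, hunit, hpack, hpar0⟩ :=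
    time_web_package_line hUrate hUcont hUmild hUdiv hUpol hUne hUhotbd hσ hσN' hκ hΓ0 hΓ2 hΓunit hΓhot hν hΓcurv hr hδ hconc hweb hρ hμ3 hslabU hevU hline
  -- the slope is negative at the hot spot (v9 literal) and on a box (continuity)
  have hson0 : ∃ A B : ℝ, ∀ z : ℝ, |z| < δ' → R 0 z = A + B * z := by
    obtain ⟨a, b, hab⟩ := hson
    exact ⟨a, b, fun z hz => hab z (lt_of_lt_of_le hz hδ'δ)⟩
  have hμneg : μ (-1) 0 < 0 := slope_neg_of_package (U := U) (R := R) (μ := μ) hδ'pos hpack hson0 hμ0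
  have hμc : Continuous fun p : ℝ × ℝ => μ (-1 + p.1) p.2 := by
    have : (fun p : ℝ × ℝ => μ (-1 + p.1) p.2) = uncurry μ ∘ fun p : ℝ × ℝ => ((-1 + p.1, p.2) : ℝ × ℝ) := by funext p; rfl
    rw [this]; exact hμ3.continuous.comp ((continuous_const.add continuous_fst).prodMk continuous_snd)
  have h00 : μ (-1 + (0 : ℝ × ℝ).1) (0 : ℝ × ℝ).2 < 0 := by simpa using hμneg
  obtain ⟨ε, hε, hεμ⟩ : ∃ ε > 0, ∀ p : ℝ × ℝ, dist p 0 < ε → μ (-1 + p.1) p.2 < 0 :=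
    Metric.eventually_nhds_iff.1 (hμc.continuousAt.eventually (gt_mem_nhds h00))
  set δs : ℝ := min δ' ε with hδs_def
  have hδspos : 0 < δs := lt_min hδ'pos hε
  have h1 : δs ≤ δ' := min_le_left _ _
  have h3 : δs ≤ ε := min_le_right _ _
  have hδsδ : δs ≤ δ := h1.trans hδ'δ
  have hδsρ : δs ≤ ρ := h1.trans hδ'ρ
  have hδsh : δs < 1 / 2 := lt_of_le_of_lt h1 hδ'h
  have hμnegB : ∀ τ z : ℝ, |τ| < δs → |z| < δs → μ (-1 + τ) z < 0 := by
    intro τ z hτ hz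
    have hd : dist ((τ, z) : ℝ × ℝ) 0 < ε := by
      rw [dist_zero_right, Prod.norm_def]
      exact max_lt (by simpa [Real.norm_eq_abs] using lt_of_lt_of_le hτ h3) (by simpa [Real.norm_eq_abs] using lt_of_lt_of_le hz h3)
    exact hεμ (τ, z) hd
  have hpackS : ∀ q : ℝ × ℝ × ℝ, |q.1| < δs → |q.2.2| < δs →
      n₀ q ∈ Ioo (-r) r ∧
      σ * U (-1 + q.1) (frameCLM (deriv Γ 0) (q.2.1, n₀ q, q.2.2)) 2 = R q.1 q.2.2 ∧
      (∀ n ∈ Icc (-r) r, n ≠ n₀ q → σ * U (-1 + q.1) (frameCLM (deriv Γ 0) (q.2.1, n, q.2.2)) 2 < R q.1 q.2.2) ∧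
      (∀ w : EuclideanSpace ℝ (Fin 3), w 2 = 0 → fderiv ℝ (fun y => U (-1 + q.1) y 2) (frameCLM (deriv Γ 0) (q.2.1, n₀ q, q.2.2)) w = 0) ∧
      (∀ m : ℕ∞, ContDiffAt ℝ m n₀ q) ∧
      0 < κt q.1 q.2.2 ∧
      fderiv ℝ (fderiv ℝ (fun y => σ * U (-1 + q.1) y 2)) (frameCLM (deriv Γ 0) (q.2.1, n₀ q, q.2.2)) (deriv Γ 0) (deriv Γ 0) +
          fderiv ℝ (fderiv ℝ (fun y => σ * U (-1 + q.1) y 2)) (frameCLM (deriv Γ 0) (q.2.1, n₀ q, q.2.2)) (Jvec (deriv Γ 0)) (Jvec (deriv Γ 0)) =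
        -κt q.1 q.2.2 ∧
      κt q.1 q.2.2 * (fderiv ℝ n₀ q ((0 : ℝ), (0 : ℝ), (1 : ℝ))) ^ 2 =
        (deriv (deriv (R q.1)) q.2.2 - μ (-1 + q.1) q.2.2 * κt q.1 q.2.2) * (1 + (fderiv ℝ n₀ q ((0 : ℝ), (1 : ℝ), (0 : ℝ))) ^ 2) :=
    fun q hq1 hq2 => hpack q (lt_of_lt_of_le hq1 h1) (lt_of_lt_of_le hq2 h1)
  have hpar0S : ∀ s z : ℝ, |z| < δs → n₀ ((0 : ℝ), s, z) = n₀ ((0 : ℝ), (0 : ℝ), z) := fun s z hz => hpar0 s z (lt_of_lt_of_le hz h1)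
  -- the frame of the straight branch
  obtain ⟨-, -, -, hνe, hfr⟩ := line_frame hline hΓ2 hΓunit hν
  have hfr0 : ∀ s z : ℝ, Γ s + z • EuclideanSpace.single 2 (1 : ℝ) = frameCLM (deriv Γ 0) (s, (0 : ℝ), z) := fun s z => by
    rw [← hfr s 0 z]; simp
  have hΓpt : ∀ s : ℝ, Γ s = frameCLM (deriv Γ 0) (s, (0 : ℝ), (0 : ℝ)) := fun s => by
    rw [← hfr s 0 0]; simp
  have hhotline : ∀ s : ℝ, U (-1) (frameCLM (deriv Γ 0) (s, (0 : ℝ), (0 : ℝ))) 2 = U (-1) 0 2 := fun s => by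
    rw [← hΓpt s]; exact hΓhot s
  have hcurvF : ∀ s : ℝ, κ ≤ -(fderiv ℝ (fderiv ℝ (fun y => σ * U (-1) y 2)) (frameCLM (deriv Γ 0) (s, (0 : ℝ), (0 : ℝ)))
      (Jvec (deriv Γ 0)) (Jvec (deriv Γ 0))) := fun s => by
    have h := hΓcurv s
    rw [hνe s, hΓpt s] at h
    exact h
  have hQ3F : ∀ τ z : ℝ, |τ| < δ → |z| < δ → ∀ s : ℝ,
      sSup ((fun n : ℝ => σ * U (-1 + τ) (frameCLM (deriv Γ 0) (s, n, z)) 2) '' Icc (-r) r) = R τ z := by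
    intro τ z hτ hz s
    have h := hQ3 τ z hτ hz s
    simp only [hfr] at h
    exact h
  have hcoldF : ∀ τ z : ℝ, |τ| < δ → |z| < δ → ∀ s n : ℝ, (n = r ∨ n = -r) → σ * U (-1 + τ) (frameCLM (deriv Γ 0) (s, n, z)) 2 < m := by
    intro τ z hτ hz s n hn
    have h := hcold τ z hτ hz s n hn
    rw [hfr] at h
    exact h
  have hhotF : ∀ τ z : ℝ, |τ| < δ → |z| < δ → ∀ s : ℝ, m ≤ σ * U (-1 + τ) (frameCLM (deriv Γ 0) (s, (0 : ℝ), z)) 2 := by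
    intro τ z hτ hz s
    have h := hhot τ z hτ hz s
    rw [hfr0] at h
    exact h
  have hconcF : ∀ τ z : ℝ, |τ| < δ → |z| < δ → ∀ s : ℝ, ∀ n ∈ Ioo (-r) r,
      fderiv ℝ (fderiv ℝ (fun y => σ * U (-1 + τ) y 2)) (frameCLM (deriv Γ 0) (s, n, z)) (Jvec (deriv Γ 0)) (Jvec (deriv Γ 0)) < 0 := by
    intro τ z hτ hz s n hn
    have h := hconc τ z hτ hz s n hn
    rw [hfr, hνe] at h
    exact h
  have hwebF : ∀ τ₀ z₀ : ℝ, |τ₀| < δ → |z₀| < δ → ∀ s₀ : ℝ, ∃ n₀ ∈ Ioo (-r) r,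
      σ * U (-1 + τ₀) (frameCLM (deriv Γ 0) (s₀, n₀, z₀)) 2 = R τ₀ z₀ ∧
      (∀ n ∈ Icc (-r) r, n ≠ n₀ → σ * U (-1 + τ₀) (frameCLM (deriv Γ 0) (s₀, n, z₀)) 2 < R τ₀ z₀) ∧
      DifferentiableAt ℝ (uncurry R) (τ₀, z₀) ∧
      fderiv ℝ (uncurry fun τ y => σ * U (-1 + τ) y 2) (τ₀, frameCLM (deriv Γ 0) (s₀, n₀, z₀)) =
        (fderiv ℝ (uncurry R) (τ₀, z₀)).comp
          ((ContinuousLinearMap.fst ℝ ℝ (EuclideanSpace ℝ (Fin 3))).prod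
            ((EuclideanSpace.proj (2 : Fin 3)).comp (ContinuousLinearMap.snd ℝ ℝ (EuclideanSpace ℝ (Fin 3))))) := by
    intro τ₀ z₀ hτ hz s₀
    obtain ⟨n₁, hn₁, hw1, hw2, hw3, hw4⟩ := hweb τ₀ z₀ hτ hz s₀
    refine ⟨n₁, hn₁, ?_, fun n hn hne => ?_, hw3, ?_⟩
    · rw [hfr] at hw1; exact hw1
    · have h := hw2 n hn hne; rw [hfr] at h; exact h
    · rw [hfr] at hw4; exact hw4
  -- CASE II: non-sonic times accumulate at `τ = 0`
  have hiso : ∀ δ'' : ℝ, 0 < δ'' → ∃ τ : ℝ, |τ| < δ'' ∧ ¬ (∃ a b : ℝ, ∀ z : ℝ, |z| < δ → R τ z = a + b * z) := by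
    intro δ'' hδ''
    by_contra h
    push Not at h
    exact hII ⟨δ'', hδ'', h⟩
  -- the LINE lever at a non-sonic time: a constant base maximiser is a pin ⇒ `False`
  have hunpin : ∀ τ : ℝ, |τ| < δs → ¬ (∃ a b : ℝ, ∀ z : ℝ, |z| < δ → R τ z = a + b * z) →
      ∃ s : ℝ, n₀ (τ, s, (0 : ℝ)) ≠ n₀ (τ, (0 : ℝ), (0 : ℝ)) := by
    intro τ hτ hnson
    by_contra hall
    push Not at hall
    have hτδ' : |τ| < δ' := lt_of_lt_of_le hτ h1
    have h0δ' : |(0 : ℝ)| < δ' := by simpa using hδ'pos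
    have hpin : ∃ c ∈ Ioo (-r) r, ∀ s : ℝ, σ * U (-1 + τ) (Γ s + c • νΓ s + (0 : ℝ) • EuclideanSpace.single 2 (1 : ℝ)) 2 = R τ 0 := by
      refine ⟨n₀ (τ, (0 : ℝ), (0 : ℝ)), (hpack (τ, (0 : ℝ), (0 : ℝ)) hτδ' h0δ').1, fun s => ?_⟩
      rw [hfr s _ 0, ← hall s]
      exact (hpack (τ, s, (0 : ℝ)) hτδ' h0δ').2.1
    have hμ1 : μ (-1 + τ) 0 < 1 := by linarith [hμnegB τ 0 hτ (by simpa using hδspos)]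
    exact line_lever_at_time hUrate hUcont hUmild hUdiv hUpol hσ hΓ2 hΓunit hν hline hδ hconc hweb hρ hμ3 hslabU
      (lt_of_lt_of_le hτ hδsδ) (lt_of_lt_of_le hτ hδsρ) (lt_trans hτ hδsh) hμ1 hpin hnson hUne
  exact hCurvedEnd C σ κ ρ δs r δ m U R μ (deriv Γ 0) n₀ κt hUrate hUcont hUmild hUdiv hUpol hUne hUhotbd hUflat hUtime hUpeak hUcrit hbil hUcurl
    hσ hσN' hκ hμ3 hρ hρ1 hslabU hevU hr hδ hδ4 he2 hunit hhotline hcurvF hQ3F hcoldF hhotF hconcF hwebF hδspos hδsδ hδsρ hδsh hpackS hpar0S hμnegB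
    hiso hunpin

end Summit.NavierStokesRegularity.NavierStokesRegularity.Theorems.PoloidalWindowDoorLrcModEntireCaseIIEntrance

end
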